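import Mathlib
import HarnessLib
import Summits.ValiantsHypothesis.ValiantsHypothesis.Theorems.MonotoneRestorationOrbitRestorationLinearVolumeQPDiNarrowSpanTight

/-!
# QUASI-POLYNOMIAL ORBITS = SQUARE SYMMETRY + POLYLOG-TREEWIDTH ONE-SORTED HOM SPAN (every family, every level)

Route MonotoneRestoration, asides `OrbitRestorationLinearVolumeQP` (stmt-ValiantsHypothesis-18294) / `OrbitCompressionQP`
(stmt-18332) / crux `OrbitRestorationQP` (stmt-18293).  The tree's one-sorted Dawar–Pago–Seppelt characterisation at
quasi-polynomial scale, `OrbitSupport.qpOrbitFamily_iff_diNarrow` (a family of polynomials on the `n × n` matrix has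
square-symmetric circuits over `ℂ` of orbit size `≤ 2^{(log₂ n + c)^c}` iff it is square-symmetric and EVENTUALLY the
closed polynomial of a one-sorted labelled pattern expression with `n^k ≤ 2^{(log₂ n + c)^c}` labels), is restated in
SPAN / TREEWIDTH currency using this hand's unfolding (`DiUnfolding.close_mem_span_diHomPoly`, p829010) and one-sorted
K2 (`DiHomPolyClose.exists_diClose_eq_diHomPoly`, p829100):

* `qpOrbitFamily_iff_diNarrowSpan` — **a family `f` has square-symmetric circuits of quasi-polynomial orbit size if and
  only if it is square-symmetric and lies, for one constant `c` and EVERY level `n`, in the `ℂ`-span of the one-sorted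
  homomorphism polynomials `dihom_{D,n}` of directed looped multigraph patterns of treewidth `≤ (log₂ n + c)^c`.**

No `VP`, no volume hypothesis, no eventuality (the finitely many small levels are absorbed in the constant by the
square-symmetric degree floor).  Honest label: currency bookkeeping (VH-free); none of the items is moved.  Def-free
helper (`--supports stmt-ValiantsHypothesis-18294`); nothing here is a named fact.

References: Dawar–Pago–Seppelt 2025 (arXiv:2502.06740) Thm 1.1, §5, Remark p. 17, §7 p. 45; Dawar–Wilsenach 2025 §6.
-/

noncomputable section

open scoped Classical

-- `Summit.ValiantsHypothesis.ValiantsHypothesis.…` is the tree's single-conjunct layout (Sub = Summit).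
set_option linter.dupNamespace false

namespace Summit.ValiantsHypothesis.ValiantsHypothesis.Theorems.OrbitSupport

open Literature.Computability.AlgebraicComplexity MvPolynomial
open Literature.Combinatorics.SimpleGraph (treewidth)
open Summit.ValiantsHypothesis.ValiantsHypothesis.Theorems

/-- **QUASI-POLYNOMIAL ORBITS = SQUARE-SYMMETRIC + NARROW ONE-SORTED HOM SPAN.**  For every family `f` of
polynomials on the `n × n` matrices over `ℂ`: there are square-symmetric labelled circuits computing `f n` with all
gate orbits of size `≤ 2^{(log₂ n + c)^c}` (one `c`, every `n`) if and only if `f` is square-symmetric (invariant under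
the diagonal renaming `x_ij ↦ x_{σ i, σ j}`) and, for one constant `c'` and every `n`, `f n` lies in the `ℂ`-span of the
one-sorted homomorphism polynomials of directed looped patterns of treewidth `≤ (log₂ n + c')^{c'}`.
(`⟹`: supports ⟹ eventually-narrow one-sorted expressions (`qpOrbitFamily_iff_diNarrow`) ⟹ unfold, small levels by
the degree floor (`OrbitRestorationLinearVolumeQPDiNarrowSpan.diNarrowSpan_of_diNarrow`); `⟸`: one-sorted K2 gives one
closed expression with `(log₂ n + c')^{c'} + 1` labels from level `1` on
(`DiHomPolyClose.diNarrowExpression_of_mem_diNarrowSpan`), `n^{W+1} ≤ 2^{(log₂ n + c' + 3)^{c'+3}}`, and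
`qpOrbitFamily_iff_diNarrow` backwards.) [cite: DawarPagoSeppelt2025, Theorem 1.1 and §7 (p. 45); DawarWilsenach2025, §6] -/
theorem qpOrbitFamily_iff_diNarrowSpan (f : (n : ℕ) → MvPolynomial (Fin n × Fin n) ℂ) :
    (∃ c : ℕ, ∀ n : ℕ, ∃ (G : Type) (_ : Fintype G)
        (C : LabelledArithCircuit ℂ (Fin n × Fin n) Unit G),
      C.IsSymmetric (Equiv.Perm (Fin n)) ∧ C.eval (C.output ()) = f n ∧
      C.orbitSize (Equiv.Perm (Fin n)) ≤ 2 ^ ((Nat.log 2 n + c) ^ c)) ↔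
    ((∀ (n : ℕ) (σ : Equiv.Perm (Fin n)), ren σ (f n) = f n) ∧
      ∃ c : ℕ, ∀ n : ℕ, f n ∈ Submodule.span ℂ {q : MvPolynomial (Fin n × Fin n) ℂ |
        ∃ (a : ℕ) (D : Multiset (Fin a × Fin a)),
          treewidth (SimpleGraph.fromRel fun u v : Fin a => ∃ e ∈ D, u = e.1 ∧ v = e.2) ≤
              (Nat.log 2 n + c) ^ c ∧
            q = diHomPoly D n ℂ}) := by
  rw [qpOrbitFamily_iff_diNarrow]
  constructor
  · rintro ⟨hinv, hdi⟩
    refine ⟨hinv, OrbitRestorationLinearVolumeQPDiNarrowSpan.diNarrowSpan_of_diNarrow f (fun n σ => ?_) hdi⟩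
    have h := hinv n σ
    have hfun : (fun x : Fin n × Fin n => σ • x) = fun ij : Fin n × Fin n => (σ ij.1, σ ij.2) :=
      funext fun _ => rfl
    unfold ren at h
    rwa [hfun] at h
  · rintro ⟨hinv, c, hc⟩
    refine ⟨hinv, c + 3, 1, fun n hn => ?_⟩
    obtain ⟨e, he⟩ := DiHomPolyClose.diNarrowExpression_of_mem_diNarrowSpan hn _ (f n) (hc n)
    exact ⟨_, e, OrbitRestorationLinearVolumeQPDiNarrowSpan.pow_polylog_succ_le_qp n c, he⟩

/-- **Corollary (span form of the support theorem)**: a family with square-symmetric circuits of quasi-polynomial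
orbit size lies on every level in the polylog-treewidth one-sorted hom span. [cite: DawarPagoSeppelt2025, Theorem 1.1 and §7 (p. 45)] -/
theorem diNarrowSpan_of_qpOrbitFamily (f : (n : ℕ) → MvPolynomial (Fin n × Fin n) ℂ)
    (h : ∃ c : ℕ, ∀ n : ℕ, ∃ (G : Type) (_ : Fintype G)
        (C : LabelledArithCircuit ℂ (Fin n × Fin n) Unit G),
      C.IsSymmetric (Equiv.Perm (Fin n)) ∧ C.eval (C.output ()) = f n ∧
      C.orbitSize (Equiv.Perm (Fin n)) ≤ 2 ^ ((Nat.log 2 n + c) ^ c)) :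
    ∃ c : ℕ, ∀ n : ℕ, f n ∈ Submodule.span ℂ {q : MvPolynomial (Fin n × Fin n) ℂ |
      ∃ (a : ℕ) (D : Multiset (Fin a × Fin a)),
        treewidth (SimpleGraph.fromRel fun u v : Fin a => ∃ e ∈ D, u = e.1 ∧ v = e.2) ≤
            (Nat.log 2 n + c) ^ c ∧
          q = diHomPoly D n ℂ} :=
  ((qpOrbitFamily_iff_diNarrowSpan f).1 h).2

/-- **Corollary (circuits from a narrow span)**: a square-symmetric family lying on every level in the
polylog-treewidth one-sorted hom span has square-symmetric circuits of quasi-polynomial orbit size (any length of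
the underlying expressions — K3). [cite: DawarPagoSeppelt2025, Theorem 1.1 and §7 (p. 45)] -/
theorem qpOrbitFamily_of_diNarrowSpan (f : (n : ℕ) → MvPolynomial (Fin n × Fin n) ℂ)
    (hinv : ∀ (n : ℕ) (σ : Equiv.Perm (Fin n)), ren σ (f n) = f n)
    (h : ∃ c : ℕ, ∀ n : ℕ, f n ∈ Submodule.span ℂ {q : MvPolynomial (Fin n × Fin n) ℂ |
      ∃ (a : ℕ) (D : Multiset (Fin a × Fin a)),
        treewidth (SimpleGraph.fromRel fun u v : Fin a => ∃ e ∈ D, u = e.1 ∧ v = e.2) ≤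
            (Nat.log 2 n + c) ^ c ∧
          q = diHomPoly D n ℂ}) :
    ∃ c : ℕ, ∀ n : ℕ, ∃ (G : Type) (_ : Fintype G)
        (C : LabelledArithCircuit ℂ (Fin n × Fin n) Unit G),
      C.IsSymmetric (Equiv.Perm (Fin n)) ∧ C.eval (C.output ()) = f n ∧
      C.orbitSize (Equiv.Perm (Fin n)) ≤ 2 ^ ((Nat.log 2 n + c) ^ c) :=
  (qpOrbitFamily_iff_diNarrowSpan f).2 ⟨hinv, h⟩

end Summit.ValiantsHypothesis.ValiantsHypothesis.Theorems.OrbitSupport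

end
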